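import Summits.BirchSwinnertonDyer.Rank1Residual.GaloisImage.TransverseCupProductVanishing
import Mathlib.GroupTheory.OrderOfElement
import Mathlib.Topology.LocallyConstant.Basic
import Mathlib.Tactic.Group
import HarnessLib

/-!
# Crux V2♭θ / V2♭∞ (stmt-BirchSwinnertonDyer-27220; line `kolyvagin_depth_split`), stub S1, piece P8 —
# cup products through a cyclic quotient of EVEN order are coboundaries when `binom(d, 2)` kills the values

The orthogonality mechanism of Mazur–Rubin Prop. 1.3.2 (ii) as pure group cohomology, at EVEN exponent
(the tree's `GaloisImage.TransverseCup.cupClass_eq_zero_of_fixed_of_cyclic` needs the values killed by an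
ODD integer, which fails for `μ_{2^M}`). For crossed homomorphisms `f`, `g` with `G`-fixed values factoring
through a character `χ : G →* Q` with open fibres and image generated by `χ σ` of order `d`:
`(f ∪ g)(σ^i, σ^j) = i j · φ(f σ, g σ)`, and the homogeneous `1`-cochain
`H(x, y) = −binom(e(χ(x⁻¹y)), 2) · φ(f σ, g σ)` (`e` an exponent of `χ(x⁻¹y)`) has `dH = f ∪ g` as soon as
`binom(d, 2) · φ(f σ, g σ) = 0` (`d · φ(f σ, g σ) = 0` is automatic): the class of `f ∪ g` in
`H²(C_d, Z) = Z / d Z` is `binom(d, 2) · φ(f σ, g σ)`. At a Kolyvagin prime `ℓ` for `p = 2` (`d = ℓ + 1`,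
`Z = μ_{2^M}`) the hypothesis reads `2^{M+1} ∣ ℓ + 1`, i.e. index `M(ℓ) ≥ M + 1` (margin one).
HONEST FRAMING: TOOL theorems of continuous group cohomology; nothing about curves; BSD is not proved here.
References: [cite: MazurRubin2004, Prop. 1.3.2 (ii) (p. 12)] [cite: Rubin2011, Prop. 1.9.5 (4)]
[cite: NeukirchSchmidtWingberg2008, Ch. I §7, Prop. 1.7.1].
-/

set_option autoImplicit false
set_option linter.dupNamespace false

noncomputable section

open CategoryTheory Function
open scoped ContRepresentation

universe u v

namespace Summit.BirchSwinnertonDyer.BirchSwinnertonDyer.Theorems.KolyvaginLowerBoundAtTwo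

namespace TransverseCupEven

open Literature.NumberTheory.GaloisRepresentations
open _root_.TopRep _root_.ContRepresentation _root_.ContinuousCohomology
open Summit.BirchSwinnertonDyer.Rank1Residual.GaloisImage.TransverseCup

/-! ## Binomial arithmetic -/

/-- `binom(a + b, 2) = binom(a, 2) + binom(b, 2) + a b`. [folklore] -/
theorem choose_two_add (a b : ℕ) : (a + b).choose 2 = a.choose 2 + b.choose 2 + a * b := by
  induction b with
  | zero => simp
  | succ b ih =>
    have h1 : (a + (b + 1)).choose 2 = (a + b).choose 1 + (a + b).choose 2 :=
      Nat.choose_succ_succ' (a + b) 1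
    have h2 : (b + 1).choose 2 = b.choose 1 + b.choose 2 := Nat.choose_succ_succ' b 1
    rw [h1, h2, ih, Nat.choose_one_right, Nat.choose_one_right]
    ring

/-- Shifting by multiples of `d` does not change `binom(·, 2) · z` when `d · z = 0`, `binom(d, 2) · z = 0`.
[folklore] -/
theorem choose_two_add_mul_smul {A : Type*} [AddCommMonoid A] (z : A) {d : ℕ} (hd : d • z = 0)
    (hd2 : d.choose 2 • z = 0) (n t : ℕ) : (n + t * d).choose 2 • z = n.choose 2 • z := by
  induction t with
  | zero => simp
  | succ t ih =>
    rw [show n + (t + 1) * d = (n + t * d) + d by ring, choose_two_add, add_smul, add_smul, ih, hd2,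
      add_zero, mul_smul, hd, smul_zero, add_zero]

/-- `binom(c, 2) · z = binom(a, 2) · z` for `c ≡ a (mod d)` when `d · z = 0` and `binom(d, 2) · z = 0`.
[folklore] -/
theorem choose_two_smul_eq_of_modEq {A : Type*} [AddCommMonoid A] (z : A) {d a c : ℕ} (hd : d • z = 0)
    (hd2 : d.choose 2 • z = 0) (h : c ≡ a [MOD d]) : c.choose 2 • z = a.choose 2 • z := by
  have hc : c = c % d + (c / d) * d := by rw [mul_comm]; exact (Nat.mod_add_div c d).symm
  have ha : a = a % d + (a / d) * d := by rw [mul_comm]; exact (Nat.mod_add_div a d).symm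
  rw [hc, ha, choose_two_add_mul_smul z hd hd2, choose_two_add_mul_smul z hd hd2]
  exact congrArg (fun m ↦ m.choose 2 • z) h

/-! ## The even-order cyclic mechanism -/

section Abstract

variable {R : Type u} [CommRing R] [TopologicalSpace R]
variable {G : Type v} [Group G] [TopologicalSpace G] [IsTopologicalGroup G] [LocallyCompactSpace G]
variable {X Y Z : TopRep.{v} R G} (φ : ContPairing X Y Z)

omit [IsTopologicalGroup G] [LocallyCompactSpace G] in
/-- A character with open fibres is locally constant. [folklore] -/
theorem isLocallyConstant_of_isOpen_fiber {Q : Type*} [Group Q] (χ : G →* Q)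
    (hχ : ∀ x₀ : G, IsOpen {x : G | χ x = χ x₀}) : IsLocallyConstant χ := by
  rw [IsLocallyConstant.iff_exists_open]
  exact fun x ↦ ⟨{x' : G | χ x' = χ x}, hχ x, rfl, fun x' hx' ↦ hx'⟩

/-- **`[f ∪ g] = 0` through a cyclic quotient of any order `d` with `binom(d, 2) · Z`-values killed.**  For
crossed homomorphisms `f : G → X`, `g : G → Y` with `G`-FIXED values, vanishing on the kernel of a character
`χ : G →* Q` with open fibres whose image is generated by `χ σ`, and `binom(orderOf (χ σ), 2) · z = 0` on
`Z`: `[f ∪ g] = 0` in `H²_cont(G, Z)` — `f ∪ g = dH` for `H(x, y) = −binom(e(χ(x⁻¹y)), 2) · φ(f σ, g σ)`.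
[cite: MazurRubin2004, Prop. 1.3.2 (ii) (p. 12)] [cite: NeukirchSchmidtWingberg2008, Prop. 1.7.1] -/
theorem cupClass_eq_zero_of_fixed_of_cyclic_even {Q : Type*} [Group Q] (χ : G →* Q)
    (hχ : ∀ x₀ : G, IsOpen {x : G | χ x = χ x₀})
    (f : contOneCocycles X) (g : contOneCocycles Y)
    (hf : ∀ s t : G, X.ρ t (f.1 s) = f.1 s) (hg : ∀ s t : G, Y.ρ t (g.1 s) = g.1 s)
    (hfH : ∀ h : G, χ h = 1 → f.1 h = 0) (hgH : ∀ h : G, χ h = 1 → g.1 h = 0)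
    (σ : G) (hcyc : ∀ s : G, ∃ i : ℕ, χ s = χ σ ^ i)
    (hZ : ∀ z : Z, (orderOf (χ σ)).choose 2 • z = 0) :
    φ.cupClass f g = 0 := by
  classical
  -- an exponent function on `Q`
  have hcyc' : ∀ q : Q, ∃ i : ℕ, (∃ s, χ s = q) → q = χ σ ^ i := by
    intro q
    by_cases hq : ∃ s, χ s = q
    · obtain ⟨s, rfl⟩ := hq
      obtain ⟨i, hi⟩ := hcyc s
      exact ⟨i, fun _ ↦ hi⟩
    · exact ⟨0, fun h ↦ absurd h hq⟩
  choose e he using hcyc'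
  have he' : ∀ s : G, χ s = χ σ ^ e (χ s) := fun s ↦ he (χ s) ⟨s, rfl⟩
  set z₀ : Z := φ.toLin (f.1 σ) (g.1 σ) with hz₀
  -- `d · z₀ = 0` (from `f(σ^d) = 0`) and `binom(d, 2) · z₀ = 0`
  have hdz : orderOf (χ σ) • z₀ = 0 := by
    have h1 : f.1 (σ ^ orderOf (χ σ)) = 0 := hfH _ (by rw [map_pow, pow_orderOf_eq_one])
    rw [apply_pow_of_fixed f hf] at h1
    have h2 : φ.toLin (orderOf (χ σ) • f.1 σ) (g.1 σ) = orderOf (χ σ) • z₀ := by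
      rw [map_nsmul, LinearMap.smul_apply]
    rw [← h2, h1, map_zero, LinearMap.zero_apply]
  have hd2 : (orderOf (χ σ)).choose 2 • z₀ = 0 := hZ z₀
  -- `z₀` is `G`-fixed
  have hz₀fix : ∀ s : G, Z.ρ s z₀ = z₀ := fun s ↦ by
    rw [hz₀, ← φ.toLin_smul, hf, hg]
  -- the cobounding cochain `H(x, y) = -binom(e(χ(x⁻¹y)), 2) · z₀`
  have hloc : IsLocallyConstant (fun p : G × G ↦ χ (p.1⁻¹ * p.2)) :=
    (isLocallyConstant_of_isOpen_fiber χ hχ).comp_continuous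
      ((continuous_fst.inv).mul continuous_snd)
  let H : C(G × G, Z) :=
    ⟨fun p ↦ -((e (χ (p.1⁻¹ * p.2))).choose 2 • z₀),
      (hloc.comp (fun q : Q ↦ -((e q).choose 2 • z₀))).continuous⟩
  have hH : ∀ x y, H (x, y) = -((e (χ (x⁻¹ * y))).choose 2 • z₀) := fun _ _ ↦ rfl
  have hHinv : ∀ s x y : G, Z.ρ s (H (s⁻¹ * x, s⁻¹ * y)) = H (x, y) := by
    intro s x y
    rw [hH, hH, show (s⁻¹ * x)⁻¹ * (s⁻¹ * y) = x⁻¹ * y by group, map_neg, map_nsmul, hz₀fix]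
  unfold ContPairing.cupClass
  rw [cxClass_eq_zero_iff _ 2 3 up_nat_next_two 1 up_nat_prev_two]
  refine ⟨ContPairing.oneCochainOfFun H hHinv, Subtype.ext ?_⟩
  refine ContinuousMap.ext fun x => ContinuousMap.ext fun y => ContinuousMap.ext fun z => ?_
  rw [ContPairing.d_one_two_apply, ContPairing.oneCochainOfFun_apply, ContPairing.oneCochainOfFun_apply,
    ContPairing.oneCochainOfFun_apply, ContPairing.cupTwoCochain_apply, hH, hH, hH]
  have ha := he' (x⁻¹ * y)
  have hb := he' (y⁻¹ * z)
  have hc := he' (x⁻¹ * z)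
  -- `c ≡ a + b (mod d)`
  have hmod : e (χ (x⁻¹ * z)) ≡ e (χ (x⁻¹ * y)) + e (χ (y⁻¹ * z)) [MOD orderOf (χ σ)] := by
    refine pow_eq_pow_iff_modEq.mp ?_
    rw [← hc, pow_add, ← ha, ← hb, ← map_mul]
    congr 1
    group
  have hCc : (e (χ (x⁻¹ * z))).choose 2 • z₀ =
      (e (χ (x⁻¹ * y))).choose 2 • z₀ + (e (χ (y⁻¹ * z))).choose 2 • z₀ +
        (e (χ (x⁻¹ * y)) * e (χ (y⁻¹ * z))) • z₀ := by
    rw [choose_two_smul_eq_of_modEq z₀ hdz hd2 hmod, choose_two_add, add_smul, add_smul]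
  -- the right-hand side
  have hR : φ.toLin (f.1 y - f.1 x) (g.1 z - g.1 y) = (e (χ (x⁻¹ * y)) * e (χ (y⁻¹ * z))) • z₀ := by
    rw [← apply_inv_mul_of_fixed f hf x y, ← apply_inv_mul_of_fixed g hg y z,
      apply_eq_smul_of_fixed_of_ker χ f hf hfH ha, apply_eq_smul_of_fixed_of_ker χ g hg hgH hb]
    simp only [map_nsmul, LinearMap.smul_apply]
    rw [mul_comm, mul_smul, hz₀]
  rw [hR, hCc]
  abel

/-- **`[f ∪ g] = 0` for crossed homomorphisms PRINCIPAL on `ker χ`**, even-order version of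
`TransverseCup.cupClass_eq_zero_of_principal_of_cyclic` (inflation–restriction by hand, then
`cupClass_eq_zero_of_fixed_of_cyclic_even`). [cite: MazurRubin2004, Prop. 1.3.2 (ii) (p. 12)] -/
theorem cupClass_eq_zero_of_principal_of_cyclic_even {Q : Type*} [Group Q] (χ : G →* Q)
    (hχ : ∀ x₀ : G, IsOpen {x : G | χ x = χ x₀})
    (f : contOneCocycles X) (g : contOneCocycles Y)
    (hXc : ∀ x : X, Continuous fun s : G => X.ρ s x) (hYc : ∀ y : Y, Continuous fun s : G => Y.ρ s y)
    (hXI : ∀ (s : G) (x : X), (∀ h : G, χ h = 1 → X.ρ h x = x) → X.ρ s x = x)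
    (hYI : ∀ (s : G) (y : Y), (∀ h : G, χ h = 1 → Y.ρ h y = y) → Y.ρ s y = y)
    (hfH : ∃ x : X, ∀ h : G, χ h = 1 → f.1 h = X.ρ h x - x)
    (hgH : ∃ y : Y, ∀ h : G, χ h = 1 → g.1 h = Y.ρ h y - y)
    (σ : G) (hcyc : ∀ s : G, ∃ i : ℕ, χ s = χ σ ^ i)
    (hZ : ∀ z : Z, (orderOf (χ σ)).choose 2 • z = 0) :
    φ.cupClass f g = 0 := by
  obtain ⟨x, hx⟩ := hfH
  obtain ⟨y, hy⟩ := hgH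
  let px : contOneCocycles X := ⟨⟨fun s => X.ρ s x - x, (hXc x).sub continuous_const⟩, fun s t => by
    change X.ρ (s * t) x - x = (X.ρ s x - x) + X.ρ s (X.ρ t x - x)
    rw [map_mul, map_sub]
    change X.ρ s (X.ρ t x) - x = (X.ρ s x - x) + (X.ρ s (X.ρ t x) - X.ρ s x)
    abel⟩
  let py : contOneCocycles Y := ⟨⟨fun s => Y.ρ s y - y, (hYc y).sub continuous_const⟩, fun s t => by
    change Y.ρ (s * t) y - y = (Y.ρ s y - y) + Y.ρ s (Y.ρ t y - y)
    rw [map_mul, map_sub]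
    change Y.ρ s (Y.ρ t y) - y = (Y.ρ s y - y) + (Y.ρ s (Y.ρ t y) - Y.ρ s y)
    abel⟩
  have hpx : oneCocycleClass X px = 0 := (oneCocycleClass_eq_zero_iff X px).2 ⟨x, fun _ => rfl⟩
  have hpy : oneCocycleClass Y py = 0 := (oneCocycleClass_eq_zero_iff Y py).2 ⟨y, fun _ => rfl⟩
  have hf' : oneCocycleClass X f = oneCocycleClass X (f - px) := by
    rw [oneCocycleClass_sub, hpx, sub_zero]
  have hg' : oneCocycleClass Y g = oneCocycleClass Y (g - py) := by
    rw [oneCocycleClass_sub, hpy, sub_zero]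
  rw [φ.cupClass_congr_left g hf', φ.cupClass_congr_right (f - px) hg']
  have hfH' : ∀ h : G, χ h = 1 → (f - px).1 h = 0 := fun h hh => by
    change f.1 h - (X.ρ h x - x) = 0
    rw [hx h hh, sub_self]
  have hgH' : ∀ h : G, χ h = 1 → (g - py).1 h = 0 := fun h hh => by
    change g.1 h - (Y.ρ h y - y) = 0
    rw [hy h hh, sub_self]
  exact cupClass_eq_zero_of_fixed_of_cyclic_even φ χ hχ (f - px) (g - py)
    (fixed_of_vanishing_of_ker χ (f - px) hXI hfH') (fixed_of_vanishing_of_ker χ (g - py) hYI hgH')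
    hfH' hgH' σ hcyc hZ

/-- **`a ∪ b = 0` for classes whose representatives are principal on `ker χ`**, even-order version of
`TransverseCup.cupProduct_eq_zero_of_principal_of_cyclic`. [cite: MazurRubin2004, Prop. 1.3.2 (ii) (p. 12)] -/
theorem cupProduct_eq_zero_of_principal_of_cyclic_even {Q : Type*} [Group Q] (χ : G →* Q)
    (hχ : ∀ x₀ : G, IsOpen {x : G | χ x = χ x₀})
    (a : continuousCohomology 1 X) (b : continuousCohomology 1 Y)
    (hXc : ∀ x : X, Continuous fun s : G => X.ρ s x) (hYc : ∀ y : Y, Continuous fun s : G => Y.ρ s y)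
    (hXI : ∀ (s : G) (x : X), (∀ h : G, χ h = 1 → X.ρ h x = x) → X.ρ s x = x)
    (hYI : ∀ (s : G) (y : Y), (∀ h : G, χ h = 1 → Y.ρ h y = y) → Y.ρ s y = y)
    (ha : ∀ f : contOneCocycles X, oneCocycleClass X f = a →
      ∃ x : X, ∀ h : G, χ h = 1 → f.1 h = X.ρ h x - x)
    (hb : ∀ g : contOneCocycles Y, oneCocycleClass Y g = b →
      ∃ y : Y, ∀ h : G, χ h = 1 → g.1 h = Y.ρ h y - y)
    (σ : G) (hcyc : ∀ s : G, ∃ i : ℕ, χ s = χ σ ^ i)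
    (hZ : ∀ z : Z, (orderOf (χ σ)).choose 2 • z = 0) :
    φ.cupProduct a b = 0 := by
  obtain ⟨f, rfl⟩ := oneCocycleClass_surjective X a
  obtain ⟨g, rfl⟩ := oneCocycleClass_surjective Y b
  rw [ContPairing.cupProduct_oneCocycleClass]
  exact cupClass_eq_zero_of_principal_of_cyclic_even φ χ hχ f g hXc hYc hXI hYI (ha f rfl) (hb g rfl)
    σ hcyc hZ

end Abstract

end TransverseCupEven

end Summit.BirchSwinnertonDyer.BirchSwinnertonDyer.Theorems.KolyvaginLowerBoundAtTwo

end
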